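import Mathlib
import HarnessLib
import Summits.HubbardSuperconductivity.HubbardSuperconductivity.Theorems.KLProgrammeKLRegimeSplitFlowPairArrayVariation
import Summits.HubbardSuperconductivity.HubbardSuperconductivity.Theorems.KLProgrammeKLRegimeSplitValueIdentification

/-!
# Route `KLProgramme` — crux K3 gen 8, CHILD 1 (stmt-HubbardSuperconductivity-20438) in scheme F-II: the `U`-CURRENCY TOTAL VARIATION ACROSS SCALES, keyed on the
# QUARTIC `↑↓` VALUES `λ_j^{↑↓}[K_j](k₁,k₂,k₃)` (two legs on the Cooper ball, third leg free) — `quarticValueVariation_of_edgeClauses_explicit`, `quarticValueAllScales_of_edgeClauses_explicit`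

Cell gate-hubbard-kl, seat hubbard-kl-k3c1-p1 (g19; child-1 lineage; technique «composed-map remainder propagation»).  Sequel to `…KLRegimeSplitFlowPairArrayVariation`
(`pairArrayVariation_of_edgeClauses_explicit`): by the pointwise identity `klka_quarticValue_eq_pairAmplitude` (`…SplitValueIdentification`:
`λₙ^{↑↓}[K](k₁, k₂, k₃) = 𝒞ₙ[K](k₁ + k₃; k₂, k₁)`, any frame, any momenta) the pair-amplitude statements ARE statements about the quartic `(0,1)` values read as child 1
reads them (`quarticValueF_le_of_pairArrayAtV17F`, `…SplitChildOneStepF`: legs `k₁, k₂ ∈ klBall L μ 0`, `k₃` free, total momentum `k₁ + k₃`).  So, under the hypotheses of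
`pairArrayAtV17F_of_edgeClauses_explicit` VERBATIM: **`quarticValueVariation_of_edgeClauses_explicit`** —
`Σ_{j<n} ‖λ_{j+1}^{↑↓}[K_{j+1}](k₁,k₂,k₃) − λ_j^{↑↓}[K_j](k₁,k₂,k₃)‖ ≤ (11/9)·U + (C_W + klLegKappa·CR·Klam³)·U²` for all `k₁, k₂ ∈ klBall L μ 0` and ALL `k₃`
(uniform in `n`; the pinned Cooper transfer `k₁ + k₃ ≈ 0` included); **`quarticValueAllScales_of_edgeClauses_explicit`** — per `(k₁, k₃)` ONE comparison sequence `u`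
(exact repulsive Riccati law `u (i+1) = u i/(1 + W i·u i)`, `|W i| ≤ m i ≤ bhi`, `16·U·Σ(m − W) ≤ 1`, quasi-monotonicity, `Σ|u (i+1) − u i| ≤ (257/225)·U`) with
`0 ≤ u j ≤ 2|U|` and `‖λ_j^{↑↓}[K_j](k₁,k₂,k₃) − u j‖ ≤ (C_W + klLegKappa·CR·Klam³)·U²` for every `j ≤ n` and every `k₂` in the ball, plus the in-class increment law.
These are the value-side inputs, keyed on `klQuarticValue`, for the «S3 IN U-CURRENCY» line (pen g25 (R368)(A), (R379)(B)): a per-scale value-INCREMENT family whose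
scale sum is `U`-currency.  They do NOT touch the sectorised `L¹` norm.  No registered text and no landed file is touched; nothing asserts the hypotheses for the model,
nor superconductivity.  Everything is proved; no definitions.
-/

noncomputable section

namespace Summit.HubbardSuperconductivity.HubbardSuperconductivity.Theorems.KLRegimeSplit

set_option linter.dupNamespace false -- summit = problem name (single-conjunct summit), D-0017

open Real Finset Literature.MathematicalPhysics.QuantumLattice Literature.Probability.LatticeModels
open Summit.HubbardSuperconductivity.HubbardSuperconductivity.Theorems.KLProgrammeLegKernels
open Summit.HubbardSuperconductivity.HubbardSuperconductivity.Theorems.CooperChannelRiccatiFlow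
open Summit.HubbardSuperconductivity.HubbardSuperconductivity.Theorems.SWaveCascade

section Model

variable (L M : ℕ) [NeZero L] [NeZero M]

variable {G : GeoConsts} {P : SplitConsts} {Qc : EngConsts}

/-- **`U`-currency total variation across scales of the quartic `↑↓` values** (hypotheses of `pairArrayAtV17F_of_edgeClauses_explicit` VERBATIM); see the module docstring. -/
theorem quarticValueVariation_of_edgeClauses_explicit (hG : G.WF) (hP : P.WF) (hQc : Qc.WF) {β U μ : ℝ} (hU : 0 ≤ U) {n : ℕ} {sG sQ tG tQ : ℝ}
    (hsG : 0 ≤ sG) (hsQ : 0 ≤ sQ) (htG : 0 ≤ tG) (htQ : 0 ≤ tQ)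
    (hκ : 12 * (tQ + sQ) + tQ ≤ klLegKappa)
    (X : ℕ → TorusSite 2 L → TorusSite 2 L → TorusSite 2 L → ℝ) (hX0 : ∀ j Qm k k', 0 ≤ X j Qm k k')
    (hXsup : ∀ j Qm k k', X j Qm k k' ≤ sG * (G.CF * (P.Klam * U) ^ 2) + sQ * (Qc.CR * P.Klam ^ 3 * U ^ 2))
    (hXsum : ∀ (t : ℕ) (Qm k k' : TorusSite 2 L),
      ∑ j ∈ Ioc t n, X j Qm k k' ≤ tG * (G.CF * (P.Klam * U) ^ 2) + tQ * (Qc.CR * P.Klam ^ 3 * U ^ 2))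
    (hXtot : ∀ Qm k k' : TorusSite 2 L,
      X 0 Qm k k' + ∑ i ∈ range n, X (i + 1) Qm k k' ≤ tG * (G.CF * (P.Klam * U) ^ 2) + tQ * (Qc.CR * P.Klam ^ 3 * U ^ 2))
    (δ : ℕ → TorusSite 2 L → ℝ)
    (hneg : ∀ Qm : TorusSite 2 L, ∀ t ≤ n, IsPairClassAt L Qm t → 16 * U * ∑ i ∈ range t, δ (i + 1) Qm ≤ 1)
    (h0 : ∀ Qm : TorusSite 2 L, ∀ k ∈ klBall L μ 0, ∀ k' ∈ klBall L μ 0,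
      ‖klPairAmplitude L M β U μ (klFlowFrameU L M β U μ 0) 0 Qm k k' - (U : ℂ)‖ ≤ initDevBar G U + X 0 Qm k k')
    (hsteps : ∀ j, 1 ≤ j → j ≤ n → ∀ Qm : TorusSite 2 L, IsPairClassAt L Qm j →
      ∃ w : TorusSite 2 L → ℝ, (∑ p, |w p| ≤ G.bhi) ∧ (∑ p, (|w p| - w p) ≤ δ j Qm) ∧
        ∃ N : Matrix (TorusSite 2 L) (TorusSite 2 L) ℂ,
          (1 + Matrix.diagonal (fun p => (w p : ℂ)) * klPairArrayF L M β U μ (j - 1) Qm) * N = 1 ∧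
          ∀ k ∈ klBall L μ 0, ∀ k' ∈ klBall L μ 0,
            ‖klPairAmplitude L M β U μ (klFlowFrameU L M β U μ j) j Qm k k' - (klPairArrayF L M β U μ (j - 1) Qm * N) k k'‖ ≤
              drivePBar G P U (j - 1) + eremBar G P Qc U β L (j - 1) + X j Qm k k')
    (hincr : ∀ j, 1 ≤ j → j ≤ n → ∀ Qm : TorusSite 2 L, ∀ k ∈ klBall L μ 0, ∀ k' ∈ klBall L μ 0,
      ‖klPairAmplitude L M β U μ (klFlowFrameU L M β U μ j) j Qm k k' - klPairAmplitude L M β U μ (klFlowFrameU L M β U μ (j - 1)) (j - 1) Qm k k'‖ ≤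
        gainBar G P U j (klTorusNorm L Qm) (klTorusNorm L (k - k')) (klTorusNorm L (k + k' - Qm)) +
          eremBar G P Qc U β L (j - 1) + X j Qm k k')
    (hUCR : 2 * Qc.CR * P.Klam ^ 3 * |U| ≤ 1) (hL : 17 * ∑ j ∈ range n, Qc.CL β j / L ≤ U ^ 2)
    (hsmall : 8 * 42 * (((∑ χ : D4Irrep, (G.abot χ + G.atop χ) + 1) +
        2 * (G.aplus * P.Klam ^ 2 * G.Z + G.cloc * P.Klam ^ 2 * (1 - (4 : ℝ) ^ (-G.θ))⁻¹ + 1) + 1 +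
          (tG + sG) * (G.CF * P.Klam ^ 2) + (tQ + sQ) * (Qc.CR * P.Klam ^ 3)) * U ^ 2) * (G.bhi * n) ≤ 1)
    (hCW : 12 * (∑ χ : D4Irrep, (G.abot χ + G.atop χ) + 1) +
        25 * (G.aplus * P.Klam ^ 2 * G.Z + G.cloc * P.Klam ^ 2 * (1 - (4 : ℝ) ^ (-G.θ))⁻¹ + 1) + 2 +
          (12 * (tG + sG) + 3 + tG) * (G.CF * P.Klam ^ 2) ≤ P.C_W) :
    ∀ k₁ ∈ klBall L μ 0, ∀ k₂ ∈ klBall L μ 0, ∀ k₃ : TorusSite 2 L,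
      ∑ i ∈ range n, ‖klQuarticValue L M β U μ (klFlowFrameU L M β U μ (i + 1)) (i + 1) 0 1 k₁ k₂ k₃ -
          klQuarticValue L M β U μ (klFlowFrameU L M β U μ i) i 0 1 k₁ k₂ k₃‖ ≤
        11 / 9 * U + (P.C_W + klLegKappa * Qc.CR * P.Klam ^ 3) * U ^ 2 := by
  intro k₁ hk₁ k₂ hk₂ k₃
  obtain ⟨u, W, m, -, -, -, -, -, -, -, -, -, -, htv⟩ :=
    pairArrayVariation_of_edgeClauses_explicit L M hG hP hQc hU hsG hsQ htG htQ hκ X hX0 hXsup hXsum hXtot δ hneg h0 hsteps hincr hUCR hL hsmall hCW (k₁ + k₃)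
  simp only [klka_quarticValue_eq_pairAmplitude]
  exact htv k₂ hk₂ k₁ hk₁

/-- **The all-scales comparison law keyed on the quartic `↑↓` values** (hypotheses of `pairArrayAtV17F_of_edgeClauses_explicit` VERBATIM): per `(k₁, k₃)` ONE sequence `u`
with its signed cascade masses — exact law, mass bounds, negative-mass line, quasi-monotonicity, total variation `≤ (257/225)·U` — enveloping the quartic values
within `(C_W + klLegKappa·CR·Klam³)·U²` at every `j ≤ n`, every `k₂` in the ball, plus the in-class increment law. -/
theorem quarticValueAllScales_of_edgeClauses_explicit (hG : G.WF) (hP : P.WF) (hQc : Qc.WF) {β U μ : ℝ} (hU : 0 ≤ U) {n : ℕ} {sG sQ tG tQ : ℝ}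
    (hsG : 0 ≤ sG) (hsQ : 0 ≤ sQ) (htG : 0 ≤ tG) (htQ : 0 ≤ tQ)
    (hκ : 12 * (tQ + sQ) + tQ ≤ klLegKappa)
    (X : ℕ → TorusSite 2 L → TorusSite 2 L → TorusSite 2 L → ℝ) (hX0 : ∀ j Qm k k', 0 ≤ X j Qm k k')
    (hXsup : ∀ j Qm k k', X j Qm k k' ≤ sG * (G.CF * (P.Klam * U) ^ 2) + sQ * (Qc.CR * P.Klam ^ 3 * U ^ 2))
    (hXsum : ∀ (t : ℕ) (Qm k k' : TorusSite 2 L),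
      ∑ j ∈ Ioc t n, X j Qm k k' ≤ tG * (G.CF * (P.Klam * U) ^ 2) + tQ * (Qc.CR * P.Klam ^ 3 * U ^ 2))
    (hXtot : ∀ Qm k k' : TorusSite 2 L,
      X 0 Qm k k' + ∑ i ∈ range n, X (i + 1) Qm k k' ≤ tG * (G.CF * (P.Klam * U) ^ 2) + tQ * (Qc.CR * P.Klam ^ 3 * U ^ 2))
    (δ : ℕ → TorusSite 2 L → ℝ)
    (hneg : ∀ Qm : TorusSite 2 L, ∀ t ≤ n, IsPairClassAt L Qm t → 16 * U * ∑ i ∈ range t, δ (i + 1) Qm ≤ 1)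
    (h0 : ∀ Qm : TorusSite 2 L, ∀ k ∈ klBall L μ 0, ∀ k' ∈ klBall L μ 0,
      ‖klPairAmplitude L M β U μ (klFlowFrameU L M β U μ 0) 0 Qm k k' - (U : ℂ)‖ ≤ initDevBar G U + X 0 Qm k k')
    (hsteps : ∀ j, 1 ≤ j → j ≤ n → ∀ Qm : TorusSite 2 L, IsPairClassAt L Qm j →
      ∃ w : TorusSite 2 L → ℝ, (∑ p, |w p| ≤ G.bhi) ∧ (∑ p, (|w p| - w p) ≤ δ j Qm) ∧
        ∃ N : Matrix (TorusSite 2 L) (TorusSite 2 L) ℂ,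
          (1 + Matrix.diagonal (fun p => (w p : ℂ)) * klPairArrayF L M β U μ (j - 1) Qm) * N = 1 ∧
          ∀ k ∈ klBall L μ 0, ∀ k' ∈ klBall L μ 0,
            ‖klPairAmplitude L M β U μ (klFlowFrameU L M β U μ j) j Qm k k' - (klPairArrayF L M β U μ (j - 1) Qm * N) k k'‖ ≤
              drivePBar G P U (j - 1) + eremBar G P Qc U β L (j - 1) + X j Qm k k')
    (hincr : ∀ j, 1 ≤ j → j ≤ n → ∀ Qm : TorusSite 2 L, ∀ k ∈ klBall L μ 0, ∀ k' ∈ klBall L μ 0,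
      ‖klPairAmplitude L M β U μ (klFlowFrameU L M β U μ j) j Qm k k' - klPairAmplitude L M β U μ (klFlowFrameU L M β U μ (j - 1)) (j - 1) Qm k k'‖ ≤
        gainBar G P U j (klTorusNorm L Qm) (klTorusNorm L (k - k')) (klTorusNorm L (k + k' - Qm)) +
          eremBar G P Qc U β L (j - 1) + X j Qm k k')
    (hUCR : 2 * Qc.CR * P.Klam ^ 3 * |U| ≤ 1) (hL : 17 * ∑ j ∈ range n, Qc.CL β j / L ≤ U ^ 2)
    (hsmall : 8 * 42 * (((∑ χ : D4Irrep, (G.abot χ + G.atop χ) + 1) +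
        2 * (G.aplus * P.Klam ^ 2 * G.Z + G.cloc * P.Klam ^ 2 * (1 - (4 : ℝ) ^ (-G.θ))⁻¹ + 1) + 1 +
          (tG + sG) * (G.CF * P.Klam ^ 2) + (tQ + sQ) * (Qc.CR * P.Klam ^ 3)) * U ^ 2) * (G.bhi * n) ≤ 1)
    (hCW : 12 * (∑ χ : D4Irrep, (G.abot χ + G.atop χ) + 1) +
        25 * (G.aplus * P.Klam ^ 2 * G.Z + G.cloc * P.Klam ^ 2 * (1 - (4 : ℝ) ^ (-G.θ))⁻¹ + 1) + 2 +
          (12 * (tG + sG) + 3 + tG) * (G.CF * P.Klam ^ 2) ≤ P.C_W) :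
    ∀ k₁ ∈ klBall L μ 0, ∀ k₃ : TorusSite 2 L, ∃ u W m : ℕ → ℝ, u 0 = U ∧ (∀ i, u (i + 1) = u i / (1 + W i * u i)) ∧
      (∀ i, |W i| ≤ m i ∧ m i ≤ G.bhi) ∧
      (∀ i < n, IsPairClassAt L (k₁ + k₃) (i + 1) → m i - W i ≤ δ (i + 1) (k₁ + k₃)) ∧
      (∀ i, (n ≤ i ∨ ¬ IsPairClassAt L (k₁ + k₃) (i + 1)) → W i = 0 ∧ m i = 0) ∧
      16 * U * ∑ i ∈ range n, (m i - W i) ≤ 1 ∧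
      (∀ i j, i ≤ j → j ≤ n → u j ≤ u i + (16 / 15 * U) ^ 2 * ∑ l ∈ Ico i j, (m l - W l)) ∧
      ∑ i ∈ range n, |u (i + 1) - u i| ≤ 257 / 225 * U ∧
      (∀ j ≤ n, 0 ≤ u j ∧ u j ≤ 2 * |U| ∧ ∀ k₂ ∈ klBall L μ 0,
        ‖klQuarticValue L M β U μ (klFlowFrameU L M β U μ j) j 0 1 k₁ k₂ k₃ - (u j : ℂ)‖ ≤ (P.C_W + klLegKappa * Qc.CR * P.Klam ^ 3) * U ^ 2) ∧
      (∀ i < n, IsPairClassAt L (k₁ + k₃) (i + 1) → ∀ k₂ ∈ klBall L μ 0,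
        ‖klQuarticValue L M β U μ (klFlowFrameU L M β U μ (i + 1)) (i + 1) 0 1 k₁ k₂ k₃ -
            klQuarticValue L M β U μ (klFlowFrameU L M β U μ i) i 0 1 k₁ k₂ k₃ - ((u (i + 1) - u i : ℝ) : ℂ)‖ ≤
          m i * ((P.C_W + klLegKappa * Qc.CR * P.Klam ^ 3) * U ^ 2 *
              (7 / 3 * U + 13 / 12 * ((P.C_W + klLegKappa * Qc.CR * P.Klam ^ 3) * U ^ 2))) +
            (drivePBar G P U i + eremBar G P Qc U β L i) + X (i + 1) (k₁ + k₃) k₂ k₁) := by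
  intro k₁ hk₁ k₃
  obtain ⟨u, W, m, hu0, hlaw, hWm, hdef, hzero, hnegm, hqm, htv, henv, hinc, -⟩ :=
    pairArrayVariation_of_edgeClauses_explicit L M hG hP hQc hU hsG hsQ htG htQ hκ X hX0 hXsup hXsum hXtot δ hneg h0 hsteps hincr hUCR hL hsmall hCW (k₁ + k₃)
  refine ⟨u, W, m, hu0, hlaw, hWm, hdef, hzero, hnegm, hqm, htv, fun j hj => ?_, fun i hi hQ k₂ hk₂ => ?_⟩
  · obtain ⟨h0j, h2j, hd⟩ := henv j hj
    exact ⟨h0j, h2j, fun k₂ hk₂ => by rw [klka_quarticValue_eq_pairAmplitude]; exact hd k₂ hk₂ k₁ hk₁⟩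
  · simp only [klka_quarticValue_eq_pairAmplitude]
    exact hinc i hi hQ k₂ hk₂ k₁ hk₁

end Model

end Summit.HubbardSuperconductivity.HubbardSuperconductivity.Theorems.KLRegimeSplit

end
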